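import Summits.ResolutionOfSingularities.ResolutionOfSingularities.Theorems.SharpStrataSepExcModelsModelSpreadsAvatars
import HarnessLib

/-!
# Separable regular birational local models descend along separable residue extensions

Line `birth` of crux `SharpStrata.SepExcModels` (stmt-ResolutionOfSingularities-16828,
`Cruxes/SepExcModels/Lines/birth.lean`), lead c1, tool stub (T4, ring form)
`stub_model_descends`, PROVED.

Setting ("bluntness descends"): `R` local, `K` a field over `R`, `C = R[c] ⊆ K` (`c` finite),
`R' = C_𝔭` realised inside `K` with `R → R'` local (`𝔪_R ↦ 𝔪_{R'}`) and `κ(R') / κ(R)` formally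
smooth; and `R'` carries the third disjunct of `SepExcAt` in ring form: `B' = R'[s'] ⊆ K`
(`s'` finite), a prime `𝔮'` of `B'` over `𝔪_{R'}` with `B'_{𝔮'}` regular and `(B'/𝔮')[1/g']`
smooth over `κ(R')` for some `g' ∉ 𝔮'`. Conclusion: `R` carries it too.

## Proof

* `B := R[c ∪ s'] ⊆ K`. Then `C ⊆ B ⊆ B'` inside `K`, and `B'` is the LOCALISATION of `B` at the
  elements that become units in `B'` (`isLocalization_adjoin_of_subset`: every element of `R'`
  is `a/u` with `a ∈ C`, `u ∈ C ∖ 𝔭`, so every element of `R'[s']` is `b/u` with `b ∈ B`).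
* `𝔮 := 𝔮' ∩ B` is a prime over `𝔪_R` (the map `R → B → B'` is `R → R' → B'`), and
  `B_𝔮 ≅ B'_{𝔮'}` is regular (`isRegularLocalRing_iff_of_isLocalization`).
* `D := B/𝔮 → B'/𝔮' =: T` is surjective on stalks with kernel zero, so `Frac D ≅ Frac T ⊇ T[1/g']`;
  `T[1/g']` is formally smooth over `κ(R')`, which is formally smooth over `κ(R)`, so `D` is
  smooth over `κ(R)` at its generic point (`isSmoothAt_bot_of_avatar`); `D` is of finite type
  over the field `κ(R)`, so it is smooth over `κ(R)` on a non-empty basic open `D(g)`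
  (openness of the smooth locus, `Algebra.IsSmoothAt.exists_notMem_smooth`).

Implementation note: the inclusion `B → B'` is `Subalgebra.inclusion` into
`B'.restrictScalars R` (for the composite `R → R'`), and `C ⊆ B` is transported as a membership
statement; hand-rolled inclusion homomorphisms between these subalgebras make the kernel's
definitional unfolding prohibitively slow.

## Sources

* A. Benito, O. Piltant, A. J. Reguera, *Small irreducible components of arc spaces in positive
  characteristic*, J. Pure Appl. Algebra 226 (2022) 107113, Lemma 4.2 (dual statement).
  [BenitoPiltantReguera2022]
* The Stacks Project, Tags 00TB/00TA (smooth locus is open). [StacksProject]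
-/

noncomputable section

-- single-problem summit: the doubled namespace component `ResolutionOfSingularities` is forced
set_option linter.dupNamespace false

open IsLocalRing
open Summit.ResolutionOfSingularities.ResolutionOfSingularities.Theorems.SepExcModels.ModelSpreads

namespace Summit.ResolutionOfSingularities.ResolutionOfSingularities.Theorems.SepExcModels.ModelDescends

/-- **`R'[s']` is a localisation of `R[t]` when `R' = M⁻¹ R[c]` inside a field and
`R[c] ⊆ R[t] ⊇ s'`.** Let `C = R[c] ⊆ B = R[t]` and `B ⊆ B' = R'[s']` inside the field `K` (the
latter presented as an algebra map preserving the values in `K`), where `R' = M⁻¹C → K` and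
`s' ⊆ B`. Then `B'` is the localisation of `B` at the elements of `B` that become units in `B'`.
[folklore] -/
theorem isLocalization_adjoin_of_subset {R K R' : Type*} [CommRing R] [Field K] [Algebra R K]
    {c t s' : Set K} (M : Submonoid (Algebra.adjoin R c)) [CommRing R']
    [Algebra (Algebra.adjoin R c) R'] [IsLocalization M R'] [Algebra R' K]
    [IsScalarTower (Algebra.adjoin R c) R' K]
    [Algebra (Algebra.adjoin R t) (Algebra.adjoin R' s')]
    (halg : ∀ x : Algebra.adjoin R t,
      (algebraMap (Algebra.adjoin R t) (Algebra.adjoin R' s') x : K) = x)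
    (hct : ∀ a : Algebra.adjoin R c, (a : K) ∈ Algebra.adjoin R t)
    (hs' : s' ⊆ Algebra.adjoin R t) :
    IsLocalization ((IsUnit.submonoid (Algebra.adjoin R' s')).comap
      (algebraMap (Algebra.adjoin R t) (Algebra.adjoin R' s'))) (Algebra.adjoin R' s') := by
  -- every element of `R'[s']` is `b / m` with `b ∈ R[t]`, `m ∈ M`
  have key : ∀ z ∈ Algebra.adjoin R' s', ∃ b ∈ Algebra.adjoin R t, ∃ m ∈ M,
      z * ((m : Algebra.adjoin R c) : K) = b := by
    intro z hz
    refine Algebra.adjoin_induction (fun x hx => ?_) (fun r => ?_) (fun x y _ _ hx hy => ?_)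
      (fun x y _ _ hx hy => ?_) hz
    · exact ⟨x, hs' hx, 1, M.one_mem, by simp⟩
    · obtain ⟨⟨a, m⟩, hm⟩ := IsLocalization.surj M r
      refine ⟨(a : K), hct a, m, m.2, ?_⟩
      change algebraMap R' K r * algebraMap (Algebra.adjoin R c) K m = algebraMap _ K a
      rw [IsScalarTower.algebraMap_apply (Algebra.adjoin R c) R' K, ← map_mul, hm,
        ← IsScalarTower.algebraMap_apply]
    · obtain ⟨b₁, hb₁, m₁, hm₁, h₁⟩ := hx
      obtain ⟨b₂, hb₂, m₂, hm₂, h₂⟩ := hy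
      refine ⟨b₁ * (m₂ : K) + b₂ * (m₁ : K),
        Subalgebra.add_mem _ (Subalgebra.mul_mem _ hb₁ (hct m₂))
          (Subalgebra.mul_mem _ hb₂ (hct m₁)), m₁ * m₂, M.mul_mem hm₁ hm₂, ?_⟩
      rw [← h₁, ← h₂]
      push_cast
      ring
    · obtain ⟨b₁, hb₁, m₁, hm₁, h₁⟩ := hx
      obtain ⟨b₂, hb₂, m₂, hm₂, h₂⟩ := hy
      refine ⟨b₁ * b₂, Subalgebra.mul_mem _ hb₁ hb₂, m₁ * m₂, M.mul_mem hm₁ hm₂, ?_⟩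
      rw [← h₁, ← h₂]
      push_cast
      ring
  -- `M ⊆ B` becomes units in `B'`: `B → B'` sends `m` to the image of `m` under `C → R' → B'`
  have hmapM : ∀ m : Algebra.adjoin R c,
      algebraMap (Algebra.adjoin R t) (Algebra.adjoin R' s') ⟨(m : K), hct m⟩ =
        algebraMap R' (Algebra.adjoin R' s') (algebraMap (Algebra.adjoin R c) R' m) := by
    intro m
    apply Subtype.ext
    rw [halg, Subalgebra.coe_algebraMap, ← IsScalarTower.algebraMap_apply]
    rfl
  have hunit : ∀ m ∈ M, (⟨(m : K), hct m⟩ : Algebra.adjoin R t) ∈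
      (IsUnit.submonoid (Algebra.adjoin R' s')).comap
        (algebraMap (Algebra.adjoin R t) (Algebra.adjoin R' s')) := by
    intro m hm
    rw [Submonoid.mem_comap, IsUnit.mem_submonoid_iff, hmapM]
    exact (IsLocalization.map_units R' (⟨m, hm⟩ : M)).map _
  refine ⟨?_, ?_, ?_⟩
  · rintro ⟨n, hn⟩
    rw [Submonoid.mem_comap, IsUnit.mem_submonoid_iff] at hn
    exact hn
  · intro b
    obtain ⟨x, hx, m, hm, h⟩ := key b.1 b.2
    refine ⟨⟨⟨x, hx⟩, ⟨⟨(m : K), hct m⟩, hunit m hm⟩⟩, ?_⟩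
    apply Subtype.ext
    change (b : K) * (algebraMap (Algebra.adjoin R t) (Algebra.adjoin R' s')
      ⟨(m : K), hct m⟩ : K) = (algebraMap (Algebra.adjoin R t) (Algebra.adjoin R' s') ⟨x, hx⟩ : K)
    rw [halg, halg]
    exact h
  · intro x y hxy
    refine ⟨1, ?_⟩
    have : (x : K) = y := by
      have h := congrArg (fun z : Algebra.adjoin R' s' => (z : K)) hxy
      simpa only [halg] using h
    rw [Subtype.ext this]

/-- **Smoothness at the generic point spreads to a basic open, in the presentation of the stub.**
For `S → A`, ideals `I ≤ 𝔮 ∩ S` with `𝔮` prime, if `D = A/𝔮` is finitely presented over `S/I` and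
smooth over `S/I` at its generic point, then `D[1/g]` is smooth over `S/I` for some `g ∉ 𝔮`
(openness of the smooth locus, `Algebra.IsSmoothAt.exists_notMem_smooth`), the `S/I`-structure
on `D[1/g]` being the composite `S/I → A/𝔮 → D[1/g]`. [cite: StacksProject, Tag 00TB] -/
theorem exists_smooth_away_of_isSmoothAt_bot {S A : Type*} [CommRing S] [CommRing A]
    [Algebra S A] (I : Ideal S) (𝔮 : Ideal A) [𝔮.IsPrime] (hle : I ≤ 𝔮.comap (algebraMap S A))
    (hfp : @Algebra.FinitePresentation (S ⧸ I) (A ⧸ 𝔮) _ _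
      (Ideal.Quotient.algebraQuotientOfLEComap hle))
    (hsm : @Algebra.IsSmoothAt (S ⧸ I) (A ⧸ 𝔮) _ _
      (Ideal.Quotient.algebraQuotientOfLEComap hle) ⊥ _) :
    ∃ g : A, g ∉ 𝔮 ∧ @Algebra.Smooth (S ⧸ I) _ (Localization.Away (Ideal.Quotient.mk 𝔮 g)) _
      ((algebraMap _ (Localization.Away (Ideal.Quotient.mk 𝔮 g))).comp
        (Ideal.quotientMap 𝔮 (algebraMap S A) hle)).toAlgebra := by
  letI := Ideal.Quotient.algebraQuotientOfLEComap hle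
  haveI := hfp
  haveI := hsm
  obtain ⟨t, ht, htsm⟩ := Algebra.IsSmoothAt.exists_notMem_smooth (S ⧸ I) (⊥ : Ideal (A ⧸ 𝔮))
  obtain ⟨g, rfl⟩ := Ideal.Quotient.mk_surjective t
  refine ⟨g, fun hg => ht (Ideal.mem_bot.mpr (Ideal.Quotient.eq_zero_iff_mem.mpr hg)), ?_⟩
  -- the `S/I`-structure of the statement is the one of `D[1/g]`
  have key : ((algebraMap (A ⧸ 𝔮) (Localization.Away (Ideal.Quotient.mk 𝔮 g))).comp
      (Ideal.quotientMap 𝔮 (algebraMap S A) hle)).toAlgebra =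
      (inferInstance : Algebra (S ⧸ I) (Localization.Away (Ideal.Quotient.mk 𝔮 g))) :=
    Algebra.algebra_ext _ _ fun r => (IsScalarTower.algebraMap_apply (S ⧸ I) (A ⧸ 𝔮)
      (Localization.Away (Ideal.Quotient.mk 𝔮 g)) r).symm
  rw [key]
  exact htsm

/-- **STUB (T4, ring form): a separable regular model DESCENDS along an essentially finite-type
birational local extension with separable residue field extension.** Let `R ⊆ K` be local,
`R' = (R[c])_𝔭 ⊆ K` (`c` finite, `𝔭` over `𝔪_R`) with `κ(R')/κ(R)` formally smooth (= separable,
the extension being finitely generated), and let `R'` carry the third disjunct of `SepExcAt`: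
`B' = R'[s']`, `𝔮'` over `𝔪_{R'}`, `B'_{𝔮'}` regular, `(B'/𝔮')[1/g']` smooth over `κ(R')`. Then `R`
carries it too: `B := R[c ∪ s']`, `𝔮 := 𝔮' ∩ B`, `B_𝔮 = B'_{𝔮'}` (`B'` is a localisation of `B`,
`isLocalization_adjoin_of_subset`), and `Frac(B/𝔮) = Frac(B'/𝔮')` is formally smooth over
`κ(R')`, hence over `κ(R)`, so the finitely generated `κ(R)`-domain `B/𝔮` is smooth on a
non-empty open (`isSmoothAt_bot_of_avatar`, openness of the smooth locus). Contrapositive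
(with `π : Y' → Y` birational, `ζ' ↦ ζ`): over a SHARP `ζ` every `ζ'` with `κ(ζ')/κ(ζ)` separable is
sharp. [cite: BenitoPiltantReguera2022, Lemma 4.2 (dual statement); folklore] -/
theorem stub_model_descends {R K : Type} [CommRing R] [IsLocalRing R] [Field K] [Algebra R K]
    (c : Finset K) (𝔭 : Ideal (Algebra.adjoin R (c : Set K))) [𝔭.IsPrime]
    (R' : Type) [CommRing R'] [IsLocalRing R'] [Algebra (Algebra.adjoin R (c : Set K)) R']
    [IsLocalization.AtPrime R' 𝔭] [Algebra R' K]
    [IsScalarTower (Algebra.adjoin R (c : Set K)) R' K]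
    (hloc : IsLocalRing.maximalIdeal R ≤ (IsLocalRing.maximalIdeal R').comap
      ((algebraMap (Algebra.adjoin R (c : Set K)) R').comp
        (algebraMap R (Algebra.adjoin R (c : Set K)))))
    (hsep : @Algebra.FormallySmooth (R ⧸ IsLocalRing.maximalIdeal R)
      (R' ⧸ IsLocalRing.maximalIdeal R') _ _
      (Ideal.quotientMap (IsLocalRing.maximalIdeal R')
        ((algebraMap (Algebra.adjoin R (c : Set K)) R').comp
          (algebraMap R (Algebra.adjoin R (c : Set K)))) hloc).toAlgebra)
    (s' : Finset K) (𝔮' : Ideal (Algebra.adjoin R' (s' : Set K))) [𝔮'.IsPrime]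
    (hle' : IsLocalRing.maximalIdeal R' ≤
      𝔮'.comap (algebraMap R' (Algebra.adjoin R' (s' : Set K))))
    (hreg' : IsRegularLocalRing (Localization.AtPrime 𝔮'))
    (g' : Algebra.adjoin R' (s' : Set K)) (hg' : g' ∉ 𝔮')
    (hsm' : @Algebra.Smooth (R' ⧸ IsLocalRing.maximalIdeal R') _
      (Localization.Away (Ideal.Quotient.mk 𝔮' g')) _
      ((algebraMap _ (Localization.Away (Ideal.Quotient.mk 𝔮' g'))).comp
        (Ideal.quotientMap 𝔮' (algebraMap R' (Algebra.adjoin R' (s' : Set K))) hle')).toAlgebra) :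
    ∃ (s : Finset K) (𝔮 : Ideal (Algebra.adjoin R (s : Set K))) (_ : 𝔮.IsPrime)
      (hle : IsLocalRing.maximalIdeal R ≤
        𝔮.comap (algebraMap R (Algebra.adjoin R (s : Set K)))),
      IsRegularLocalRing (Localization.AtPrime 𝔮) ∧
        ∃ g : Algebra.adjoin R (s : Set K), g ∉ 𝔮 ∧
          @Algebra.Smooth (R ⧸ IsLocalRing.maximalIdeal R) _
            (Localization.Away (Ideal.Quotient.mk 𝔮 g)) _
            ((algebraMap _ (Localization.Away (Ideal.Quotient.mk 𝔮 g))).comp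
              (Ideal.quotientMap 𝔮 (algebraMap R (Algebra.adjoin R (s : Set K))) hle)).toAlgebra := by
  classical
  -- (0) the composite `φ : R → C = R[c] → R'` as an algebra structure compatible with `K`
  let φ : R →+* R' :=
    (algebraMap (Algebra.adjoin R (c : Set K)) R').comp (algebraMap R (Algebra.adjoin R (c : Set K)))
  have hφK : ∀ r : R, algebraMap R' K (φ r) = algebraMap R K r := fun r => by
    change algebraMap R' K (algebraMap (Algebra.adjoin R (c : Set K)) R'
      (algebraMap R (Algebra.adjoin R (c : Set K)) r)) = _
    rw [← IsScalarTower.algebraMap_apply (Algebra.adjoin R (c : Set K)) R' K,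
      ← IsScalarTower.algebraMap_apply R (Algebra.adjoin R (c : Set K)) K]
  letI algRR' : Algebra R R' := φ.toAlgebra
  haveI : IsScalarTower R R' K := IsScalarTower.of_algebraMap_eq fun r => (hφK r).symm
  -- `B = R[c ∪ s'] ⊆ K`, `B' = R'[s'] ⊆ K`, `C ⊆ B ⊆ B'`
  let B : Subalgebra R K := Algebra.adjoin R ((c ∪ s' : Finset K) : Set K)
  let B' : Subalgebra R' K := Algebra.adjoin R' (s' : Set K)
  have hCB : Algebra.adjoin R (c : Set K) ≤ B := Algebra.adjoin_mono (by simp)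
  have hct : ∀ a : Algebra.adjoin R (c : Set K), (a : K) ∈ B := fun a => hCB a.2
  have hs'B : (s' : Set K) ⊆ B :=
    (show (s' : Set K) ⊆ ((c ∪ s' : Finset K) : Set K) by simp).trans Algebra.subset_adjoin
  have hgen : ((c ∪ s' : Finset K) : Set K) ⊆ ((B'.restrictScalars R : Subalgebra R K) : Set K) := by
    intro x hx
    rw [Finset.coe_union, Set.mem_union] at hx
    rw [SetLike.mem_coe, Subalgebra.mem_restrictScalars]
    rcases hx with hx | hx
    · have hx' : algebraMap R' K
          (algebraMap (Algebra.adjoin R (c : Set K)) R' ⟨x, Algebra.subset_adjoin hx⟩) = x := by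
        rw [← IsScalarTower.algebraMap_apply]
        rfl
      rw [← hx']
      exact B'.algebraMap_mem _
    · exact Algebra.subset_adjoin hx
  have hBB' : B ≤ B'.restrictScalars R := Algebra.adjoin_le hgen
  letI algBB' : Algebra B B' := (Subalgebra.inclusion hBB').toRingHom.toAlgebra
  have halg : ∀ x : B, (algebraMap B B' x : K) = x := fun x => Subalgebra.coe_inclusion hBB' x
  have hιR : ∀ r : R, algebraMap B B' (algebraMap R B r) = algebraMap R' B' (φ r) := fun r =>
    Subtype.ext (by rw [halg, Subalgebra.coe_algebraMap, Subalgebra.coe_algebraMap, hφK])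
  -- (1) `B'` is a localisation of `B`
  haveI hN : IsLocalization ((IsUnit.submonoid B').comap (algebraMap B B')) B' :=
    isLocalization_adjoin_of_subset 𝔭.primeCompl halg hct hs'B
  -- (2) the prime `𝔮 = 𝔮' ∩ B` over `𝔪_R`; `B_𝔮 = B'_{𝔮'}` is regular
  let 𝔮 : Ideal B := 𝔮'.comap (algebraMap B B')
  haveI h𝔮 : 𝔮.IsPrime := Ideal.comap_isPrime _ _
  have hle : maximalIdeal R ≤ 𝔮.comap (algebraMap R B) := fun r hr => by
    rw [Ideal.mem_comap, Ideal.mem_comap, hιR, ← Ideal.mem_comap]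
    exact hle' (Ideal.mem_comap.mp (hloc hr))
  have hreg : IsRegularLocalRing (Localization.AtPrime 𝔮) :=
    (isRegularLocalRing_iff_of_isLocalization ((IsUnit.submonoid B').comap (algebraMap B B'))
      𝔮' 𝔮 rfl).mp hreg'
  -- (3) smoothness of `D = B/𝔮` over `κ(R)` at the generic point
  -- residue fields `κ(R) → κ(R')`
  letI algκ : Algebra (R ⧸ maximalIdeal R) (R' ⧸ maximalIdeal R') :=
    (Ideal.quotientMap (maximalIdeal R')
      ((algebraMap (Algebra.adjoin R (c : Set K)) R').comp
        (algebraMap R (Algebra.adjoin R (c : Set K)))) hloc).toAlgebra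
  have hκ : ∀ r : R, algebraMap (R ⧸ maximalIdeal R) (R' ⧸ maximalIdeal R')
      (Ideal.Quotient.mk _ r) = Ideal.Quotient.mk _ (φ r) := fun r => rfl
  -- `T = B'/𝔮'`, `E = T[1/g']` over `κ(R')` and over `κ(R)`
  have ht0 : Ideal.Quotient.mk 𝔮' g' ≠ 0 := fun h => hg' (Ideal.Quotient.eq_zero_iff_mem.mp h)
  haveI : IsDomain (Localization.Away (Ideal.Quotient.mk 𝔮' g')) :=
    IsLocalization.isDomain_localization (powers_le_nonZeroDivisors_of_noZeroDivisors ht0)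
  letI algLE : Algebra (R' ⧸ maximalIdeal R') (Localization.Away (Ideal.Quotient.mk 𝔮' g')) :=
    ((algebraMap _ (Localization.Away (Ideal.Quotient.mk 𝔮' g'))).comp
      (Ideal.quotientMap 𝔮' (algebraMap R' B') hle')).toAlgebra
  haveI : Algebra.Smooth (R' ⧸ maximalIdeal R') (Localization.Away (Ideal.Quotient.mk 𝔮' g')) :=
    hsm'
  have hE : Algebra.FormallySmooth (R' ⧸ maximalIdeal R')
      (Localization.Away (Ideal.Quotient.mk 𝔮' g')) := Algebra.Smooth.formallySmooth
  have hLE : ∀ r : R', algebraMap (R' ⧸ maximalIdeal R') (Localization.Away (Ideal.Quotient.mk 𝔮' g'))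
      (Ideal.Quotient.mk _ r) = algebraMap _ (Localization.Away (Ideal.Quotient.mk 𝔮' g'))
        (Ideal.Quotient.mk 𝔮' (algebraMap R' B' r)) := fun r => rfl
  letI algAE : Algebra (R ⧸ maximalIdeal R) (Localization.Away (Ideal.Quotient.mk 𝔮' g')) :=
    ((algebraMap (R' ⧸ maximalIdeal R') (Localization.Away (Ideal.Quotient.mk 𝔮' g'))).comp
      (algebraMap (R ⧸ maximalIdeal R) (R' ⧸ maximalIdeal R'))).toAlgebra
  have hAE : ∀ r : R ⧸ maximalIdeal R,
      algebraMap (R ⧸ maximalIdeal R) (Localization.Away (Ideal.Quotient.mk 𝔮' g')) r =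
      algebraMap (R' ⧸ maximalIdeal R') _ (algebraMap (R ⧸ maximalIdeal R) (R' ⧸ maximalIdeal R') r) :=
    fun r => rfl
  haveI := IsScalarTower.of_algebraMap_eq (R := R ⧸ maximalIdeal R) (S := R' ⧸ maximalIdeal R')
    (A := Localization.Away (Ideal.Quotient.mk 𝔮' g')) hAE
  -- `D = B/𝔮` over `κ(R)`
  letI algAD : Algebra (R ⧸ maximalIdeal R) (B ⧸ 𝔮) := Ideal.Quotient.algebraQuotientOfLEComap hle
  have hAD : ∀ r : R, algebraMap (R ⧸ maximalIdeal R) (B ⧸ 𝔮) (Ideal.Quotient.mk _ r) =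
      Ideal.Quotient.mk 𝔮 (algebraMap R B r) := fun r => rfl
  haveI : IsScalarTower R (R ⧸ maximalIdeal R) (B ⧸ 𝔮) :=
    IsScalarTower.of_algebraMap_eq fun r => (hAD r).symm
  -- the two presentations of `κ(𝔮)`
  have hφ₁ : ((Ideal.Quotient.mk 𝔮').comp (algebraMap B B')).SurjectiveOnStalks :=
    (RingHom.surjectiveOnStalks_of_surjective Ideal.Quotient.mk_surjective).comp
      (RingHom.surjectiveOnStalks_of_isLocalization
        ((IsUnit.submonoid B').comap (algebraMap B B')) B')
  have hφ₂ : (Ideal.Quotient.mk 𝔮).SurjectiveOnStalks :=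
    RingHom.surjectiveOnStalks_of_surjective Ideal.Quotient.mk_surjective
  have hker : RingHom.ker ((Ideal.Quotient.mk 𝔮').comp (algebraMap B B')) =
      RingHom.ker (Ideal.Quotient.mk 𝔮) := by
    rw [← RingHom.comap_ker, Ideal.mk_ker, Ideal.mk_ker]
  have hsmAt : Algebra.IsSmoothAt (R ⧸ maximalIdeal R) (⊥ : Ideal (B ⧸ 𝔮)) := by
    refine isSmoothAt_bot_of_avatar (L := R' ⧸ maximalIdeal R') hsep hE (Ideal.Quotient.mk 𝔮' g')
      ht0 ((Ideal.Quotient.mk 𝔮').comp (algebraMap B B')) hφ₁ (Ideal.Quotient.mk 𝔮) hφ₂ hker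
      fun r => ?_
    obtain ⟨r, rfl⟩ := Ideal.Quotient.mk_surjective r
    refine ⟨algebraMap R B r, ?_, ?_⟩
    · rw [hAE, hκ, hLE, RingHom.comp_apply, hιR]
    · rw [hAD]
  -- (4) `D` is of finite type over the field `κ(R)`: smooth on a non-empty basic open
  haveI : Algebra.FiniteType R B := Algebra.FiniteType.adjoin_of_finite (Finset.finite_toSet _)
  haveI : Algebra.FiniteType (R ⧸ maximalIdeal R) (B ⧸ 𝔮) :=
    Algebra.FiniteType.of_restrictScalars_finiteType R _ _
  haveI : IsNoetherianRing (R ⧸ maximalIdeal R) := by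
    letI := Ideal.Quotient.field (maximalIdeal R)
    infer_instance
  haveI : Algebra.FinitePresentation (R ⧸ maximalIdeal R) (B ⧸ 𝔮) :=
    (Algebra.FinitePresentation.of_finiteType).mp ‹_›
  obtain ⟨g, hgq, hsm⟩ :=
    exists_smooth_away_of_isSmoothAt_bot (maximalIdeal R) 𝔮 hle ‹_› hsmAt
  exact ⟨c ∪ s', 𝔮, h𝔮, hle, hreg, g, hgq, hsm⟩

end Summit.ResolutionOfSingularities.ResolutionOfSingularities.Theorems.SepExcModels.ModelDescends

end
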